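import Summits.QuantumFields.BalabanUV.Gaps.EndDrawdownSeq
import Summits.QuantumFields.BalabanUV.Gaps.EndUpperPerLevel
import Summits.QuantumFields.BalabanUV.Gaps.CapSignsNecessaryFwd

/-!
# Gaps / EndDrawdownBand — THE ONE-LOOP INTERFACE OF THE END STATEMENT IS ONE NODE: bounded drawdown `DwSeq β⁰ rlo` of the one-loop
# coefficients below the line of the LOWER remainder constant.  Split-level END edges (sufficiency through this seat's per-level W-β socket
# `EndUpperPerLevel.endpointExistence_of_partialSums_locUpper` — no slope, no pin, no rate, no upper bound on `β⁰`, CAP-free), the one-sided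
# necessity (realised window inequality, upper remainder half only), and THE BAND over realization classes: quantify `EndpointExistence`
# over ALL history families whose split has one-loop part `b` and remainder in the one-sided box `[−rlo, rhi]` on the `]0,γ₀]`-histories —
# E is FORCED ⟺ `DwSeq b rlo` (the upper constant does not occur), E is POSSIBLE ⟺ `DwSeq b (−rhi)` (the lower constant does not occur);
# in between, the same one-loop part has a realization with E and one without.  A PORT into the tree, with attribution, of g1-plan-2 GEN
# 22–24's HOME kernel `HOME/g1/skeletons/B12Thm2SubDag_plan2.lean` v1.15 (sha16 6167da52388d3b3c) §11 ∕ §12 ∕ §12c ∕ §13 ∕ §13f (lens items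
# S-51 ∕ S-52 ∕ S-53 and rider R-44a), restructured B0-free and one-sided-first (cell pub-balaban-gaps, seat g1-p3 GEN 8, rows CAP ∕ tail
# «split ∕ weakening»; file 2 of «the one-loop interface of the END statement»)

HONEST FRAMING (cell rule, page 1 of everything): bookkeeping over hypothesis SHAPES on the tree's typed carriers (`FlowStep.HBeta` ∕ `Box` ∕
`BetaContH` ∕ `BetaUpperH`, `B12Beta.OneLoopSplit` ∕ `HistBox`, `Beta.RemainderChain.RemainderConst`, `FlowStepRuns.BetaPartialSumsLowerH` ∕
`modelOf`, `DagBinding.ForwardGenerated` ∕ `EndpointExistence`).  `EndpointExistence C` is the cell's END-grade statement (a tuned bare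
coupling for every cutoff — [I] Thm 2 p. 259 first sentence WITHOUT (0.31), «proof in a separate paper», UNPRINTED); here it is a CONCLUSION
of edges whose hypotheses are named in the signature, or it is QUANTIFIED over Bałaban-free data `(b, rlo, rhi, γ₀)` — `EndForcedLU` ∕
`EndPossibleLU` are quantified READINGS, not binders, not nodes.  The witnesses are the tree's (`FlowStepRuns.modelOf` realizations of the
constant-remainder families `betaShift b c`), the ¬E mechanism is the tree's realised window inequality (this seat's gen-3 port
`CapSignsNecessaryFwd.windowSum_ge_of_forwardGenerated`, g1-plan-2 X-43), the E mechanism is this seat's gen-7 port of g1-plan-2's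
per-level socket.  AUTHORSHIP: the mathematics and most Lean text are g1-plan-2 GEN 22–24's (planner seat; «g1-p3 ports with
attribution»); this seat's part: the B0-free ∕ one-sided-first restructuring (the kernel reached B0-freeness in its §13; here it is the
starting point), the theorems marked (this seat), header, docstrings, and the re-check against the tree.  For Bałaban's β the remainder
constants, `β⁰` and its limit are NOT certified (NODE-O instance 0∕1, CAP coefficients certified 0); nothing of Bałaban's is asserted;
0∕6 binders discharged; one finite T⁴ at fixed ε; NOT [I] Thm 2, NOT `BetaPertH`, NOT the continuum limit, NOT Clay.

WHAT IT SAYS FOR ROWS CAP ∕ tail ∕ (D4) (words ∕ odds of record UNCHANGED).  At END grade — the grade the print-faithful T⁴ headline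
`T4ContinuumYM4Torus.continuumYM4_torus_of_endpointExistence` consumes — the one-loop obligation is `DwSeq β⁰ rlo` and nothing else:
an EVENTUAL floor `β⁰_j ≥ f ≥ rlo` (tail alone) supplies it with NO statement about the first `k₀` coefficients
(`endpointExistence_of_eventualFloor_remainderConst`): THE CAP SERVES (0.31) ONLY.  Row (D4)'s constant-form remainder has one job
per threshold: its LOWER constant fixes the drawdown line E needs, its UPPER constant (one per level suffices,
`endpointExistence_of_dwSeq_lower_locUpper`) decides only whether E is possible at all.

CITATION HEADER (tags CONTEXT ONLY; nothing below is a printed statement).  [I] = T. Bałaban, Commun. Math. Phys. **109** (1987) 249–301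
[Balaban1987RG1]: Thm 2 p. 259 (first sentence), (0.20) p. 256, (1.22) p. 264, (2.12)–(2.14) p. 268 (the split `β = β⁰ + β¹`, `β¹ = 0` at
`g_k = 0`).
-/

namespace Summit.QuantumFields.BalabanUV.Gaps.EndDrawdownBand

open Literature.MathematicalPhysics.QuantumFieldTheory.Balaban1983to89
open Literature.MathematicalPhysics.QuantumFieldTheory.Balaban1983to89.FlowStep
open Literature.MathematicalPhysics.QuantumFieldTheory.Balaban1983to89.FlowStepRuns
open Literature.MathematicalPhysics.QuantumFieldTheory.Balaban1983to89.DagBinding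
open Literature.MathematicalPhysics.QuantumFieldTheory.Balaban1983to89.Beta.RemainderChain (RemainderConst)
open Literature.MathematicalPhysics.QuantumFieldTheory.Balaban1983to89.Beta.Drift (OneLoopDrift)
open Summit.QuantumFields.BalabanUV.Gaps.EndDrawdownSeq
open Summit.QuantumFields.BalabanUV.Gaps.EndUpperPerLevel (endpointExistence_of_partialSums_locUpper)
open Summit.QuantumFields.BalabanUV.Gaps.CapSignsNecessaryFwd (windowSum_ge_of_forwardGenerated)
open Finset

noncomputable section

variable {β : HBeta}

/-! ## §1 The one-sided remainder class and the split-level plumbing (kernel §12c ∕ §13 ∕ §13f, ported) -/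

/-- ONE-SIDED constant-form remainder class on the box `]0,γ₀]`: `−rlo ≤ β¹_{k+1} ≤ rhi` on the `]0,γ₀]`-histories — rows (Q3) ∧ (Q4) of this
seat's 2 × 2 table `WeakestBetaCurrency.Quarters`, the two halves of row (D4)'s `RemainderConst` kept apart.  A hypothesis SHAPE on the printed
split; nothing asserted (kernel §12c `RemainderLU`). [cite: Balaban1987RG1, (2.12)–(2.14) p.268] -/
def RemainderLU (Sβ : B12Beta.OneLoopSplit β) (γ₀ rlo rhi : ℝ) : Prop :=
  ∀ k p, p ∈ B12Beta.HistBox γ₀ k → -rlo ≤ Sβ.β1 k p ∧ Sβ.β1 k p ≤ rhi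

/-- Row (D4)'s `RemainderConst Sβ γ₀ rr` is the symmetric case `rlo = rhi = rr`. [folklore] -/
theorem remainderLU_of_remainderConst (Sβ : B12Beta.OneLoopSplit β) {γ₀ rr : ℝ} (h : RemainderConst Sβ γ₀ rr) :
    RemainderLU Sβ γ₀ rr rr := fun k p hp => abs_le.mp (h k p hp)

/-- … and conversely (this seat). [folklore] -/
theorem remainderLU_self_iff (Sβ : B12Beta.OneLoopSplit β) (γ₀ rr : ℝ) : RemainderLU Sβ γ₀ rr rr ↔ RemainderConst Sβ γ₀ rr :=
  ⟨fun h k p hp => abs_le.mpr (h k p hp), remainderLU_of_remainderConst Sβ⟩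

/-- The one-sided class sits inside `RemainderConst Sβ γ₀ (max rlo rhi)`. [folklore] -/
theorem remainderConst_of_remainderLU (Sβ : B12Beta.OneLoopSplit β) {γ₀ rlo rhi : ℝ} (h : RemainderLU Sβ γ₀ rlo rhi) :
    RemainderConst Sβ γ₀ (max rlo rhi) := fun k p hp =>
  abs_le.mpr ⟨by have h1 := (h k p hp).1; have h2 := le_max_left rlo rhi; linarith, (h k p hp).2.trans (le_max_right rlo rhi)⟩

/-- PLUMBING · bounded drawdown of `β⁰` below the `rlo`-line (bound `M`) ∧ the LOWER half (Q3) `−rlo ≤ β¹` on the `]0,γ₀]`-histories ⟹ the W-β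
hypothesis `BetaPartialSumsLowerH M γ₀ β` (windowed partial sums of `β` along every `]0,γ₀]`-sequence are `≥ −M`).  Only the lower remainder half is
used (kernel §11 `PS_of_Dw_T2` ∕ §13 `PS_of_Dw_LU`). [folklore] -/
theorem ps_of_dwSeq_lower (Sβ : B12Beta.OneLoopSplit β) {rlo γ₀ M : ℝ}
    (hM : ∀ k n : ℕ, k ≤ n → -M ≤ ∑ j ∈ Finset.Ico k n, (Sβ.β0 j - rlo))
    (hlo : ∀ k (p : Fin (k + 1) → ℝ), p ∈ B12Beta.HistBox γ₀ k → -rlo ≤ Sβ.β1 k p) : BetaPartialSumsLowerH M γ₀ β := by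
  intro g hg k n hkn
  have hstep : ∀ j, Sβ.β0 j - rlo ≤ β j (prefixOf g j) := fun j => by
    have hp : prefixOf g j ∈ B12Beta.HistBox γ₀ j := fun i => hg i
    have h2 := hlo j _ hp
    rw [Sβ.split j]
    linarith
  exact (hM k n hkn).trans (Finset.sum_le_sum fun j _ => hstep j)

/-- PLUMBING · PER-LEVEL upper constants on the remainder ((Q4)_k: `∃ r_k` per level, free in `k`) give the per-level bound `β_k ≤ β⁰_k + r_k` on
`Box γ₀ k` that the per-level W-β socket asks (kernel §13f `perLevelUpper_of_locUpper`). [folklore] -/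
theorem perLevelUpper_of_locUpper (Sβ : B12Beta.OneLoopSplit β) {γ₀ : ℝ}
    (hup : ∀ k : ℕ, ∃ r : ℝ, ∀ p : Fin (k + 1) → ℝ, p ∈ B12Beta.HistBox γ₀ k → Sβ.β1 k p ≤ r) :
    ∀ k : ℕ, ∃ B : ℝ, ∀ v : Fin (k + 1) → ℝ, v ∈ Box γ₀ k → β k v ≤ B := fun k => by
  obtain ⟨r, hr⟩ := hup k
  refine ⟨Sβ.β0 k + r, fun v hv => ?_⟩
  have h := hr v (histBox_of_mem_box hv)
  rw [Sβ.split k]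
  linarith

/-- PLUMBING · in the one-sided class the per-level bound is automatic: `β_k ≤ β⁰_k + rhi` (kernel §13 `perLevelUpper_of_LU`). [folklore] -/
theorem perLevelUpper_of_remainderLU (Sβ : B12Beta.OneLoopSplit β) {γ₀ rlo rhi : ℝ} (hrem : RemainderLU Sβ γ₀ rlo rhi) :
    ∀ k : ℕ, ∃ B : ℝ, ∀ v : Fin (k + 1) → ℝ, v ∈ Box γ₀ k → β k v ≤ B :=
  perLevelUpper_of_locUpper Sβ fun k => ⟨rhi, fun p hp => (hrem k p hp).2⟩

/-! ## §2 The END edges: sufficiency through the per-level W-β socket (no B0, no (UP), no slope, no pin, no rate; kernel §13 ∕ §13f, ported) -/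

/-- **THE WEAKEST TYPED (D4)-USE AT END GRADE** · forward generation ∧ `0 < γ₀` ∧ bounded drawdown `DwSeq β⁰ rlo` ∧ (Q3) with ONE uniform lower
constant `rlo` ∧ (Q4)_k with PER-LEVEL upper constants (`∀ k, ∃ r_k`, free in `k`) ∧ (C) ⟹ `EndpointExistence`.  Proof = this seat's gen-7 port of
g1-plan-2's per-level socket `EndUpperPerLevel.endpointExistence_of_partialSums_locUpper` BY NAME, fed by §1's plumbing.  NO bound on `β⁰` from
above, NO uniform upper remainder constant, NO slope, NO table, NO pin, NO rate, NO sign of any coefficient (kernel §13f `End_of_Dw_Lo_locUpper_C`).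
[cite: Balaban1987RG1, Thm 2 p.259 (first sentence)] -/
theorem endpointExistence_of_dwSeq_lower_locUpper {Cn : B12.Construction} (hgen : ForwardGenerated Cn β)
    (Sβ : B12Beta.OneLoopSplit β) {γ₀ rlo : ℝ} (hγ₀ : 0 < γ₀) (hDw : DwSeq Sβ.β0 rlo)
    (hlo : ∀ (k : ℕ) (p : Fin (k + 1) → ℝ), p ∈ B12Beta.HistBox γ₀ k → -rlo ≤ Sβ.β1 k p)
    (hup : ∀ k : ℕ, ∃ r : ℝ, ∀ p : Fin (k + 1) → ℝ, p ∈ B12Beta.HistBox γ₀ k → Sβ.β1 k p ≤ r)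
    (hcont : BetaContH γ₀ β) : EndpointExistence Cn := by
  obtain ⟨M, hM0, hM⟩ := hDw.exists_nonneg
  exact endpointExistence_of_partialSums_locUpper hgen hγ₀ hM0 hcont (ps_of_dwSeq_lower Sβ hM hlo)
    (perLevelUpper_of_locUpper Sβ hup)

/-- END EDGE over the one-sided class · fwd-gen ∧ `DwSeq β⁰ rlo` ∧ `RemainderLU Sβ γ₀ rlo rhi` ∧ (C) ⟹ E; `rhi` enters only the per-level bound
(kernel §13 `End_of_Dw_LU_C`). [cite: Balaban1987RG1, Thm 2 p.259 (first sentence)] -/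
theorem endpointExistence_of_dwSeq_remainderLU {Cn : B12.Construction} (hgen : ForwardGenerated Cn β) (Sβ : B12Beta.OneLoopSplit β)
    {γ₀ rlo rhi : ℝ} (hγ₀ : 0 < γ₀) (hDw : DwSeq Sβ.β0 rlo) (hrem : RemainderLU Sβ γ₀ rlo rhi) (hcont : BetaContH γ₀ β) :
    EndpointExistence Cn :=
  endpointExistence_of_dwSeq_lower_locUpper hgen Sβ hγ₀ hDw (fun k p hp => (hrem k p hp).1)
    (fun k => ⟨rhi, fun p hp => (hrem k p hp).2⟩) hcont

/-- END EDGE over row (D4)'s symmetric class · fwd-gen ∧ `DwSeq β⁰ rr` ∧ `RemainderConst Sβ γ₀ rr` ∧ (C) ⟹ E — the slope-free, CAP-free, pin-free,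
rate-free, upper-bound-free END edge (kernel §13 `End_of_Dw_T2_T3`; its B0-keyed ancestor §11 `End_of_Dw_B0_T2_T3` = this seat's
`WeakestBetaCurrency.Quarters.endpointExistence` at the degenerate slope). [cite: Balaban1987RG1, Thm 2 p.259 (first sentence)] -/
theorem endpointExistence_of_dwSeq_remainderConst {Cn : B12.Construction} (hgen : ForwardGenerated Cn β) (Sβ : B12Beta.OneLoopSplit β)
    {γ₀ rr : ℝ} (hγ₀ : 0 < γ₀) (hDw : DwSeq Sβ.β0 rr) (hrem : RemainderConst Sβ γ₀ rr) (hcont : BetaContH γ₀ β) :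
    EndpointExistence Cn :=
  endpointExistence_of_dwSeq_remainderLU hgen Sβ hγ₀ hDw (remainderLU_of_remainderConst Sβ hrem) hcont

/-- **THE CAP-FREE TAIL ROAD AT END GRADE** · fwd-gen ∧ an EVENTUAL floor `f ≤ β⁰_j` (`j ≥ k₀`) with `rr ≤ f` ∧ `RemainderConst Sβ γ₀ rr` ∧ (C) ⟹ E —
NO statement about the first `k₀` one-loop coefficients, no sign list, no rate, no bound on `β⁰` from above: only a TAIL statement is load-bearing
(kernel §13 `End_of_eventualFloor_T2_T3`; β-level ancestor in the tree: an4's `FlowStepRuns.endpointExistence_of_eventualLower`, which pays the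
early scales with the printed `−β′`). [cite: Balaban1987RG1, Thm 2 p.259 (first sentence) and (2.12)–(2.14) p.268] -/
theorem endpointExistence_of_eventualFloor_remainderConst {Cn : B12.Construction} (hgen : ForwardGenerated Cn β)
    (Sβ : B12Beta.OneLoopSplit β) {f rr γ₀ : ℝ} {k₀ : ℕ} (hF : ∀ j, k₀ ≤ j → f ≤ Sβ.β0 j) (hr : rr ≤ f) (hγ₀ : 0 < γ₀)
    (hrem : RemainderConst Sβ γ₀ rr) (hcont : BetaContH γ₀ β) : EndpointExistence Cn :=
  endpointExistence_of_dwSeq_remainderConst hgen Sβ hγ₀ (dwSeq_mono (dwSeq_of_eventually_ge hF) hr) hrem hcont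

/-- THE DRIFT ROAD THROUGH THE NODE · fwd-gen ∧ a drift class of `β⁰` at slope `s` (row (D1)'s shape) ∧ `RemainderConst Sβ γ₀ rr` with `rr ≤ s` ∧
(C) ⟹ E — an4's drift ∕ remainder END road re-derived THROUGH the drawdown node, without its (UP) by-product (kernel §11 `End_of_D_T2_T3_viaDw`,
B0-free). [cite: Balaban1987RG1, Thm 2 p.259 (first sentence) and (1.22) p.264] -/
theorem endpointExistence_of_oneLoopDrift_remainderConst {Cn : B12.Construction} (hgen : ForwardGenerated Cn β)
    (Sβ : B12Beta.OneLoopSplit β) {s A rr γ₀ : ℝ} (hA : OneLoopDrift s A Sβ.β0) (hr : rr ≤ s) (hγ₀ : 0 < γ₀)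
    (hrem : RemainderConst Sβ γ₀ rr) (hcont : BetaContH γ₀ β) : EndpointExistence Cn :=
  endpointExistence_of_dwSeq_remainderConst hgen Sβ hγ₀ (dwSeq_of_oneLoopDrift hA hr) hrem hcont

/-! ## §3 Necessity: END grade bounds the drawdown of `β⁰` below the `(−rhi)`-line (upper remainder half only; kernel §12c, ported) -/

/-- **ONE-SIDED NECESSITY** · a forward-generated realization with `β¹ ≤ rhi` on the `]0,γ₀]`-histories and `EndpointExistence` has `DwSeq β⁰ (−rhi)`:
E at `m = 0` on the box `min γ₀ γ₂` gives a target `g⋆`; along the length-`n` tuned run the realised window inequality reads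
`1∕g_k² − 1∕g⋆² ≤ Σ_{[k,n)} β_j(prefix) ≤ Σ_{[k,n)} (β⁰_j + rhi)`.  The LOWER half (Q3) is not used (kernel §12c `DwNeg_of_End_upper`; symmetric
ancestor in the tree: this seat's `CapTailEndNecessity.windowSum_lower_of_endpointExistence`). [cite: Balaban1987RG1, (0.20) p.256 and Thm 2 p.259] -/
theorem dwSeq_neg_of_endpointExistence_upper {Cn : B12.Construction} (hgen : ForwardGenerated Cn β) (Sβ : B12Beta.OneLoopSplit β)
    {γ₀ rhi : ℝ} (hγ₀ : 0 < γ₀) (hup : ∀ k (p : Fin (k + 1) → ℝ), p ∈ B12Beta.HistBox γ₀ k → Sβ.β1 k p ≤ rhi)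
    (hE : EndpointExistence Cn) : DwSeq Sβ.β0 (-rhi) := by
  obtain ⟨γ₂, hγ₂, hγ₂run⟩ := hE 0
  obtain ⟨gstar, hgstar, hg⟩ := hγ₂run (min γ₀ γ₂) (lt_min hγ₀ hγ₂) (min_le_right _ _)
  have hrun := hg gstar hgstar le_rfl
  refine ⟨1 / gstar ^ 2, fun k n hkn => ?_⟩
  obtain ⟨g0, hI, hend⟩ := hrun n
  set P : B12.RunParams := ⟨n, 0, g0⟩ with hP
  have hw := windowSum_ge_of_forwardGenerated hgen P hI hkn le_rfl
  have hterm : ∀ j ∈ Finset.Ico k n, β j (prefixOf (Cn P).flow.g j) ≤ Sβ.β0 j - -rhi := fun j hj => by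
    have hjn : j < n := (Finset.mem_Ico.mp hj).2
    have hp : prefixOf (Cn P).flow.g j ∈ B12Beta.HistBox γ₀ j := fun i => by
      have hi : (i : ℕ) ≤ n := by have := i.isLt; omega
      exact ⟨(hI i hi).1, (hI i hi).2.trans (min_le_left _ _)⟩
    rw [Sβ.split j, sub_neg_eq_add]
    linarith [hup j _ hp]
  have hsum := Finset.sum_le_sum hterm
  have hgk : 0 < (Cn P).flow.g k := (hI k hkn).1
  have hk0 : 0 < 1 / ((Cn P).flow.g k) ^ 2 := by positivity
  have hK : (Cn P).flow.g n = gstar := hend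
  rw [hK] at hw
  linarith

/-- Symmetric form · fwd-gen ∧ `RemainderConst Sβ γ₀ rr` ∧ E ⟹ `DwSeq β⁰ (−rr)` (kernel §11b `Dw_neg_of_End_T2`; = this seat's
`CapTailEndNecessity.windowSum_lower_of_endpointExistence` up to `x − (−rr) = x + rr`, re-derived from the one-sided form to add no import).
[cite: Balaban1987RG1, (0.20) p.256 and Thm 2 p.259] -/
theorem dwSeq_neg_of_endpointExistence_remainderConst {Cn : B12.Construction} (hgen : ForwardGenerated Cn β)
    (Sβ : B12Beta.OneLoopSplit β) {γ₀ rr : ℝ} (hγ₀ : 0 < γ₀) (hrem : RemainderConst Sβ γ₀ rr) (hE : EndpointExistence Cn) :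
    DwSeq Sβ.β0 (-rr) :=
  dwSeq_neg_of_endpointExistence_upper hgen Sβ hγ₀ (fun k p hp => (abs_le.mp (hrem k p hp)).2) hE

/-- **THE END-GRADE SANDWICH IN ONE NODE, ONE-SIDED** (this seat's packaging of kernel §11b `End_sandwich_Dw` over the one-sided class) · over a
forward-generated realization with remainder in `[−rlo, rhi]` on `]0,γ₀]` and (C): `DwSeq β⁰ rlo ⟹ E ⟹ DwSeq β⁰ (−rhi)` — one node, two
thresholds `rlo + rhi` apart; in between E is decided by the remainder's SIGN structure (§4 `band_realizations`), by nothing one-loop.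
[cite: Balaban1987RG1, Thm 2 p.259 (first sentence)] -/
theorem endpointExistence_sandwich_remainderLU {Cn : B12.Construction} (hgen : ForwardGenerated Cn β) (Sβ : B12Beta.OneLoopSplit β)
    {γ₀ rlo rhi : ℝ} (hγ₀ : 0 < γ₀) (hrem : RemainderLU Sβ γ₀ rlo rhi) (hcont : BetaContH γ₀ β) :
    (DwSeq Sβ.β0 rlo → EndpointExistence Cn) ∧ (EndpointExistence Cn → DwSeq Sβ.β0 (-rhi)) :=
  ⟨fun hDw => endpointExistence_of_dwSeq_remainderLU hgen Sβ hγ₀ hDw hrem hcont,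
    fun hE => dwSeq_neg_of_endpointExistence_upper hgen Sβ hγ₀ (fun k p hp => (hrem k p hp).2) hE⟩

/-! ## §4 The band over realization classes: both thresholds attained, the two remainder constants decouple (kernel §12 ∕ §12c ∕ §13, ported) -/

/-- QUANTIFIED READING OF THE END STATEMENT (universal) · `EndpointExistence` holds for EVERY realization of the one-loop sequence `b` with remainder
in the one-sided box `[−rlo, rhi]` on `]0,γ₀]`: every history family `β` with a printed split `Sβ` (`Sβ.β0 = b`), `RemainderLU Sβ γ₀ rlo rhi`, (C) on
the `]0,γ₀]`-boxes, and EVERY forward-generated construction of `β`.  A reading over Bałaban-free data `(b, rlo, rhi, γ₀)`; not a binder, not a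
node (kernel §12c `EndForcedLU`; the kernel's symmetric `EndForced b rr γ₀` is the case `rlo = rhi = rr`, `remainderLU_self_iff`).
[cite: Balaban1987RG1, Thm 2 p.259 (first sentence) and (2.12)–(2.14) p.268] -/
def EndForcedLU (b : ℕ → ℝ) (rlo rhi γ₀ : ℝ) : Prop :=
  ∀ (β : HBeta) (Sβ : B12Beta.OneLoopSplit β) (Cn : B12.Construction),
    (∀ j, Sβ.β0 j = b j) → RemainderLU Sβ γ₀ rlo rhi → BetaContH γ₀ β → ForwardGenerated Cn β → EndpointExistence Cn

/-- QUANTIFIED READING OF THE END STATEMENT (existential) · SOME realization of `(b, [−rlo, rhi], γ₀)` — split, (C), a forward-generated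
construction — has `EndpointExistence` (kernel §12c `EndPossibleLU`). [cite: Balaban1987RG1, Thm 2 p.259 (first sentence) and (2.12)–(2.14) p.268] -/
def EndPossibleLU (b : ℕ → ℝ) (rlo rhi γ₀ : ℝ) : Prop :=
  ∃ (β : HBeta) (Sβ : B12Beta.OneLoopSplit β) (Cn : B12.Construction),
    (∀ j, Sβ.β0 j = b j) ∧ RemainderLU Sβ γ₀ rlo rhi ∧ BetaContH γ₀ β ∧ ForwardGenerated Cn β ∧ EndpointExistence Cn

/-- THE WITNESS FAMILY · one-loop part `b`, remainder the CONSTANT `c` on every history with positive last coupling and `0` at `g_k = 0` (the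
printed vanishing); `c = −rlo` is the adversarial realization, `c = +rhi` the cooperative one.  A toy family on the tree's carrier `HBeta`;
nothing of Bałaban's (kernel §12 `betaShift`). [folklore] -/
def betaShift (b : ℕ → ℝ) (c : ℝ) : HBeta := fun k p => b k + (if 0 < p (Fin.last k) then c else 0)

/-- Its printed split: `β⁰ := b`, `β¹ := c·𝟙[g_k > 0]` (kernel §12 `splitShift`). [folklore] -/
def splitShift (b : ℕ → ℝ) (c : ℝ) : B12Beta.OneLoopSplit (betaShift b c) where
  β0 := b
  β1 := fun k p => if 0 < p (Fin.last k) then c else 0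
  split := fun _ _ => rfl
  vanish := fun k p hp => by simp [hp]

/-- On histories with positive last coupling the witness is the constant `b_k + c`. [folklore] -/
theorem betaShift_of_pos (b : ℕ → ℝ) (c : ℝ) (k : ℕ) {p : Fin (k + 1) → ℝ} (hp : 0 < p (Fin.last k)) :
    betaShift b c k p = b k + c := by
  simp [betaShift, hp]

/-- The witness lies in the one-sided class as soon as its constant does: `−rlo ≤ c ≤ rhi` (any box; kernel §12c `remainderLU_splitShift`). [folklore] -/
theorem remainderLU_splitShift (b : ℕ → ℝ) {c rlo rhi : ℝ} (h1 : -rlo ≤ c) (h2 : c ≤ rhi) (γ₀ : ℝ) :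
    RemainderLU (splitShift b c) γ₀ rlo rhi := by
  intro k p hp
  have hpos : 0 < p (Fin.last k) := (hp (Fin.last k)).1
  show -rlo ≤ (if 0 < p (Fin.last k) then c else 0) ∧ (if 0 < p (Fin.last k) then c else 0) ≤ rhi
  rw [if_pos hpos]
  exact ⟨h1, h2⟩

/-- … and in row (D4)'s symmetric class as soon as `|c| ≤ rr` (kernel §12 `remainderConst_splitShift`). [folklore] -/
theorem remainderConst_splitShift (b : ℕ → ℝ) {c rr : ℝ} (hc : |c| ≤ rr) (γ₀ : ℝ) : RemainderConst (splitShift b c) γ₀ rr :=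
  (remainderLU_self_iff _ γ₀ rr).mp (remainderLU_splitShift b (abs_le.mp hc).1 (abs_le.mp hc).2 γ₀)

/-- (C) for the witness: `β_{k+1}` is CONSTANT on each box `]0,γ₀]^{k+1}` (kernel §12 `betaContH_betaShift`). [folklore] -/
theorem betaContH_betaShift (b : ℕ → ℝ) (c γ₀ : ℝ) : BetaContH γ₀ (betaShift b c) := fun k =>
  (continuousOn_const (c := b k + c)).congr fun _ hp => betaShift_of_pos b c k ((mem_box.mp hp) (Fin.last k)).1

/-- (UP) for the witness from a bound on `b` (used only for P-layer readings; kernel §12 `betaUpperH_betaShift`). [folklore] -/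
theorem betaUpperH_betaShift (b : ℕ → ℝ) (c : ℝ) {γ₀ B : ℝ} (hB : ∀ j, b j ≤ B) : BetaUpperH (B + c) γ₀ (betaShift b c) := by
  intro k p hp
  rw [betaShift_of_pos b c k ((mem_box.mp hp) (Fin.last k)).1]
  linarith [hB k]

/-- THE ¬E MECHANISM (realised window inequality) · if ANY forward-generated construction of the witness `betaShift b c` has E, then `DwSeq b (−c)`:
fix `m = 0`, a box `γ₂` and a target `g⋆` from E; along the tuned run of length `n` the couplings are positive, so `β_{j+1}(prefix) = b_j + c`, and the
telescoped recursion reads `1∕g_k² − 1∕g⋆² ≤ Σ_{[k,n)} (b_j + c)` (kernel §12 `DwSeq_of_End_shift`). [cite: Balaban1987RG1, (0.20) p.256 and Thm 2 p.259] -/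
theorem dwSeq_of_endpointExistence_betaShift {b : ℕ → ℝ} {c : ℝ} {Cn : B12.Construction} (hgen : ForwardGenerated Cn (betaShift b c))
    (hE : EndpointExistence Cn) : DwSeq b (-c) := by
  obtain ⟨γ₂, hγ₂, hγ₂run⟩ := hE 0
  obtain ⟨gstar, hgstar, hg⟩ := hγ₂run γ₂ hγ₂ le_rfl
  have hrun := hg gstar hgstar le_rfl
  refine ⟨1 / gstar ^ 2, fun k n hkn => ?_⟩
  obtain ⟨g0, hI, hend⟩ := hrun n
  set P : B12.RunParams := ⟨n, 0, g0⟩ with hP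
  have hw := windowSum_ge_of_forwardGenerated hgen P hI hkn le_rfl
  have hterm : ∀ j ∈ Finset.Ico k n, betaShift b c j (prefixOf (Cn P).flow.g j) = b j - -c := fun j hj => by
    rw [betaShift_of_pos b c j (by simpa using (hI j (Finset.mem_Ico.mp hj).2.le).1), sub_neg_eq_add]
  rw [Finset.sum_congr rfl hterm] at hw
  have hgk : 0 < (Cn P).flow.g k := (hI k hkn).1
  have hk0 : 0 < 1 / ((Cn P).flow.g k) ^ 2 := by positivity
  have hK : (Cn P).flow.g n = gstar := hend
  rw [hK] at hw
  linarith

/-- FIRST THRESHOLD, ⟹ · E FORCED over the class ⟹ `DwSeq b rlo`, once the adversarial constant `−rlo` lies in the box (`−rlo ≤ rhi`): the remainder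
`β¹ ≡ −rlo` realised by the tree's `modelOf` is one of the realizations (kernel §12c `DwLo_of_EndForcedLU`). [cite: Balaban1987RG1, Thm 2 p.259 (first sentence)] -/
theorem dwSeq_of_endForcedLU {b : ℕ → ℝ} {rlo rhi γ₀ : ℝ} (hc : -rlo ≤ rhi) (h : EndForcedLU b rlo rhi γ₀) : DwSeq b rlo := by
  have hE : EndpointExistence (modelOf (betaShift b (-rlo))) :=
    h _ (splitShift b (-rlo)) _ (fun _ => rfl) (remainderLU_splitShift b le_rfl hc γ₀) (betaContH_betaShift b (-rlo) γ₀)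
      (modelOf_forwardGenerated _)
  have hD := dwSeq_of_endpointExistence_betaShift (modelOf_forwardGenerated _) hE
  rwa [neg_neg] at hD

/-- FIRST THRESHOLD, ⟸ · `DwSeq b rlo` ⟹ E FORCED over `[−rlo, rhi]` for EVERY upper constant `rhi` and EVERY one-loop sequence `b` — no bound on `b`
from above (kernel §13 `EndForcedLU_of_DwLo`). [cite: Balaban1987RG1, Thm 2 p.259 (first sentence)] -/
theorem endForcedLU_of_dwSeq {b : ℕ → ℝ} {rlo γ₀ : ℝ} (rhi : ℝ) (hγ₀ : 0 < γ₀) (hDw : DwSeq b rlo) : EndForcedLU b rlo rhi γ₀ := by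
  intro β Sβ Cn hb hrem hcont hgen
  have hDw' : DwSeq Sβ.β0 rlo := by
    obtain ⟨M, hM⟩ := hDw
    exact ⟨M, fun k n hkn => by simpa only [hb] using hM k n hkn⟩
  exact endpointExistence_of_dwSeq_remainderLU hgen Sβ hγ₀ hDw' hrem hcont

/-- **FIRST THRESHOLD ATTAINED** · `EndForcedLU b rlo rhi γ₀ ⟺ DwSeq b rlo` (`0 < γ₀`, nonempty box `−rlo ≤ rhi`): THE UPPER REMAINDER CONSTANT DOES
NOT OCCUR — E forced over the class is bounded drawdown of the one-loop part below the LOWER constant's line, for every `b`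
(kernel §13 `EndForcedLU_iff_DwLo'`). [cite: Balaban1987RG1, Thm 2 p.259 (first sentence) and (2.12)–(2.14) p.268] -/
theorem endForcedLU_iff_dwSeq {b : ℕ → ℝ} {rlo rhi γ₀ : ℝ} (hγ₀ : 0 < γ₀) (hc : -rlo ≤ rhi) :
    EndForcedLU b rlo rhi γ₀ ↔ DwSeq b rlo :=
  ⟨dwSeq_of_endForcedLU hc, endForcedLU_of_dwSeq rhi hγ₀⟩

/-- The UPPER remainder constant is irrelevant for FORCED: enlarge or shrink it at will (kernel §13 `EndForcedLU_irrel_hi'`). [folklore] -/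
theorem endForcedLU_irrel_hi {b : ℕ → ℝ} {rlo rhi₁ γ₀ : ℝ} (rhi₂ : ℝ) (hγ₀ : 0 < γ₀) (h1 : -rlo ≤ rhi₁)
    (h : EndForcedLU b rlo rhi₁ γ₀) : EndForcedLU b rlo rhi₂ γ₀ :=
  endForcedLU_of_dwSeq rhi₂ hγ₀ (dwSeq_of_endForcedLU h1 h)

/-- SECOND THRESHOLD, ⟸ · `DwSeq b (−rhi)` ⟹ E POSSIBLE over `[−rlo, rhi]` (nonempty box): the cooperative remainder `β¹ ≡ +rhi` realised by `modelOf`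
lies in the class `[−(−rhi), rhi]` too, so §2's END edge applies with `DwSeq b (−rhi)` — no bound on `b` from above (kernel §13 `EndPossibleLU_of_DwNegHi`).
[cite: Balaban1987RG1, Thm 2 p.259 (first sentence)] -/
theorem endPossibleLU_of_dwSeq_neg {b : ℕ → ℝ} {rlo rhi γ₀ : ℝ} (hγ₀ : 0 < γ₀) (hc : -rlo ≤ rhi) (hDw : DwSeq b (-rhi)) :
    EndPossibleLU b rlo rhi γ₀ :=
  ⟨betaShift b rhi, splitShift b rhi, modelOf (betaShift b rhi), fun _ => rfl, remainderLU_splitShift b hc le_rfl γ₀,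
    betaContH_betaShift b rhi γ₀, modelOf_forwardGenerated _,
    endpointExistence_of_dwSeq_remainderLU (modelOf_forwardGenerated _) (splitShift b rhi) hγ₀ hDw
      (remainderLU_splitShift b (neg_neg rhi).le le_rfl γ₀) (betaContH_betaShift b rhi γ₀)⟩

/-- SECOND THRESHOLD, ⟹ · SOME realization in the class with E ⟹ `DwSeq b (−rhi)` (§3, upper half only; kernel §12c `DwNegHi_of_EndPossibleLU`).
[cite: Balaban1987RG1, Thm 2 p.259 (first sentence)] -/
theorem dwSeq_neg_of_endPossibleLU {b : ℕ → ℝ} {rlo rhi γ₀ : ℝ} (hγ₀ : 0 < γ₀) (h : EndPossibleLU b rlo rhi γ₀) : DwSeq b (-rhi) := by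
  obtain ⟨β, Sβ, Cn, hb, hrem, -, hgen, hE⟩ := h
  obtain ⟨D, hD⟩ := dwSeq_neg_of_endpointExistence_upper hgen Sβ hγ₀ (fun k p hp => (hrem k p hp).2) hE
  exact ⟨D, fun k n hkn => by simpa only [hb] using hD k n hkn⟩

/-- **SECOND THRESHOLD ATTAINED** · `EndPossibleLU b rlo rhi γ₀ ⟺ DwSeq b (−rhi)` (`0 < γ₀`, `−rlo ≤ rhi`): THE LOWER REMAINDER CONSTANT DOES NOT
OCCUR (kernel §13 `EndPossibleLU_iff_DwNegHi'`). [cite: Balaban1987RG1, Thm 2 p.259 (first sentence) and (2.12)–(2.14) p.268] -/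
theorem endPossibleLU_iff_dwSeq_neg {b : ℕ → ℝ} {rlo rhi γ₀ : ℝ} (hγ₀ : 0 < γ₀) (hc : -rlo ≤ rhi) :
    EndPossibleLU b rlo rhi γ₀ ↔ DwSeq b (-rhi) :=
  ⟨dwSeq_neg_of_endPossibleLU hγ₀, endPossibleLU_of_dwSeq_neg hγ₀ hc⟩

/-- The LOWER remainder constant is irrelevant for POSSIBLE (kernel §13 `EndPossibleLU_irrel_lo'`). [folklore] -/
theorem endPossibleLU_irrel_lo {b : ℕ → ℝ} {rlo₁ rhi γ₀ : ℝ} (rlo₂ : ℝ) (hγ₀ : 0 < γ₀) (h2 : -rlo₂ ≤ rhi)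
    (h : EndPossibleLU b rlo₁ rhi γ₀) : EndPossibleLU b rlo₂ rhi γ₀ :=
  endPossibleLU_of_dwSeq_neg hγ₀ h2 (dwSeq_neg_of_endPossibleLU hγ₀ h)

/-- FORCED ⟹ POSSIBLE over a nonempty class (this seat; via the two thresholds and `dwSeq_mono`, since `−rhi ≤ rlo`). [folklore] -/
theorem endPossibleLU_of_endForcedLU {b : ℕ → ℝ} {rlo rhi γ₀ : ℝ} (hγ₀ : 0 < γ₀) (hc : -rlo ≤ rhi) (h : EndForcedLU b rlo rhi γ₀) :
    EndPossibleLU b rlo rhi γ₀ :=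
  endPossibleLU_of_dwSeq_neg hγ₀ hc (dwSeq_mono (dwSeq_of_endForcedLU hc h) (by linarith))

/-- **THE BAND IS INTRINSIC** · in the band `DwSeq b (−rhi) ∧ ¬ DwSeq b rlo` (nonempty box) E is POSSIBLE and NOT FORCED over the class — for EVERY
one-loop sequence `b`, no bound from above (kernel §13 `band_undecided_LU'`). [cite: Balaban1987RG1, Thm 2 p.259 (first sentence) and (2.12)–(2.14) p.268] -/
theorem band_undecided_LU {b : ℕ → ℝ} {rlo rhi γ₀ : ℝ} (hγ₀ : 0 < γ₀) (hc : -rlo ≤ rhi) (hlo : DwSeq b (-rhi))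
    (hhi : ¬ DwSeq b rlo) : EndPossibleLU b rlo rhi γ₀ ∧ ¬ EndForcedLU b rlo rhi γ₀ :=
  ⟨endPossibleLU_of_dwSeq_neg hγ₀ hc hlo, fun h => hhi (dwSeq_of_endForcedLU hc h)⟩

/-- THE BAND, SPELLED OUT · in the band the pair `(b, [−rlo, rhi])` has, on the same box, one realization WITH `EndpointExistence` and one WITHOUT —
same one-loop part, same remainder class; only the remainder's SIGN differs (`β¹ ≡ +rhi` versus `β¹ ≡ −rlo`, both realised by `modelOf`).  There E
is decided by the remainder's sign structure, by NOTHING a one-loop analysis can see (kernel §12 `band_undecided`, B0-free and one-sided).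
[cite: Balaban1987RG1, Thm 2 p.259 (first sentence) and (2.12)–(2.14) p.268] -/
theorem band_realizations {b : ℕ → ℝ} {rlo rhi γ₀ : ℝ} (hγ₀ : 0 < γ₀) (hc : -rlo ≤ rhi) (hlo : DwSeq b (-rhi))
    (hhi : ¬ DwSeq b rlo) :
    (∃ (β : HBeta) (Sβ : B12Beta.OneLoopSplit β) (Cn : B12.Construction),
        (∀ j, Sβ.β0 j = b j) ∧ RemainderLU Sβ γ₀ rlo rhi ∧ BetaContH γ₀ β ∧ ForwardGenerated Cn β ∧ EndpointExistence Cn) ∧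
      ∃ (β : HBeta) (Sβ : B12Beta.OneLoopSplit β) (Cn : B12.Construction),
        (∀ j, Sβ.β0 j = b j) ∧ RemainderLU Sβ γ₀ rlo rhi ∧ BetaContH γ₀ β ∧ ForwardGenerated Cn β ∧ ¬ EndpointExistence Cn := by
  refine ⟨endPossibleLU_of_dwSeq_neg hγ₀ hc hlo, betaShift b (-rlo), splitShift b (-rlo), modelOf (betaShift b (-rlo)),
    fun _ => rfl, remainderLU_splitShift b le_rfl hc γ₀, betaContH_betaShift b (-rlo) γ₀, modelOf_forwardGenerated _, fun hE => hhi ?_⟩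
  have hD := dwSeq_of_endpointExistence_betaShift (modelOf_forwardGenerated _) hE
  rwa [neg_neg] at hD

/-- WIDTH REDUCTION · over `[−rlo, rhi]` E is forced iff it is forced over the SYMMETRIC box of row (D4)'s size `rlo` (`0 ≤ rlo`, `−rlo ≤ rhi`)
(kernel §13 `EndForcedLU_iff_EndForced'`). [folklore] -/
theorem endForcedLU_iff_symmetric {b : ℕ → ℝ} {rlo rhi γ₀ : ℝ} (hγ₀ : 0 < γ₀) (hlo : 0 ≤ rlo) (hc : -rlo ≤ rhi) :
    EndForcedLU b rlo rhi γ₀ ↔ EndForcedLU b rlo rlo γ₀ := by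
  rw [endForcedLU_iff_dwSeq hγ₀ hc, endForcedLU_iff_dwSeq hγ₀ (by linarith)]

end

end Summit.QuantumFields.BalabanUV.Gaps.EndDrawdownBand
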